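import Summits.NavierStokesRegularity.OSWSelfSimilar.TypeIIInnerLimitMasterDatum
import Literature.Analysis.FluidPDE.LeiZhang2017AxisymmetricCriteria
import HarnessLib

/-!
# A witness of the certificate class `CertifiedBlowupVorticityRateBlowup` (stmt-NavierStokesRegularity-8639) at the velocity
# scale: the inner object's vorticity decays like `C/|s|` into the past, and in the swirling branch (β) the running velocity
# maximum obeys the TYPE-I RATE along the gauge times

Theorems file landed `--supports stmt-NavierStokesRegularity-8639` (cell `ns-blowup`, GROUP B zone Z1 → the certificate
crux of route CertifiedBlowup). A witness of the certificate class is a witness `(ν, T, u, p)` of `CertifiedBlowupAxisymBlowup`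
which moreover obeys the dynamic-rescaling rate `(T − t)‖ω(t)‖_∞ ≤ C_ω` as `t ↑ T` (what a Chen–Hou-type certificate with a
bounded rescaled profile delivers). Feeding that rate into the zone-Z1 master theorem on datum-level hypotheses
(`Summit.NavierStokesRegularity.OSWSelfSimilar.TypeIIModulationDictionary.innerObject_master_of_datum`, part XXXV) gives, by
pure bookkeeping of the gauge N-a zoom (`tₖ → T`, scales `λₖ → 0` with `(λₖ/ν)‖u‖ ≤ 1` on `[0, tₖ] × ℝ³`, zoom
`y ↦ (λₖ/ν)u(tₖ + (λₖ²/ν)s, cₖ + λₖy) → W`, zoomed vorticity `(λₖ²/ν)ω → curl W`):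

* `vorticityRate_innerObject_curl_le` — **the inner object's vorticity decays into the past**: `‖curl W(s)(y)‖ ≤ C_ω/|s|`
  for all `s < 0`, `y` (the rate is scale-invariant: `(λₖ²/ν)·C_ω/(T − tₖ − (λₖ²/ν)s) ≤ C_ω/|s|`);
* `vorticityRate_typeI_along_gauge_of_curl_ne_zero` — **in the swirling branch the blow-up is Type I ALONG THE GAUGE TIMES**:
  if `curl W(s₀)(y₀) ≠ 0` (branch (β) of the Z1 alternative; in branch (α) the zoomed vorticity tends to `0`), then for all
  large `k` the zoomed remaining lifetime is bounded, `ν(T − tₖ) ≤ (2C_ω/‖curl W(s₀)(y₀)‖)·λₖ²`, hence the running maximum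
  obeys `‖u(t, x)‖²(T − tₖ) ≤ 2νC_ω/‖curl W(s₀)(y₀)‖` for all `(t, x) ∈ [0, tₖ] × ℝ³` — the KNSS-forbidden rate
  `|u| ≲ (T−t)^{−1/2}` realised along the sequence `tₖ` (KNSS 2009 / Seregin–Šverák 2009 exclude it only when it holds for ALL
  `t`, so this is a constraint, not a contradiction);
* `vorticityRate_witness_innerObject_alternative` — the assembled statement for every witness of the certificate class:
  the Z1 data and inner object, the `C_ω/|s|` vorticity decay, and EITHER (α) a constant unit inner object with zoomed
  vorticity `→ 0`, OR (β) `¬AxisymmetricLiouvilleBoundedSwirl` witnessed by `W` together with the Type-I rate along the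
  gauge times.

No new definitions, no named-fact hypotheses, no `sorry`. WHAT THIS IS NOT: not a blow-up or regularity claim and no word
on (AX-L) — implications about a HYPOTHETICAL certificate-class witness. Author: ns-blowup-profile-eng-1 g9, 2026-08-27.

## References
* G. Koch, N. Nadirashvili, G. Seregin, V. Šverák, Acta Math. 203 (2009), §6. [KochNadirashviliSereginSverak2009]
* T. Y. Hou, Found. Comput. Math. 23 (2022) = arXiv:2107.06509 (dynamic rescaling). [Hou2022PotentiallySingularNS]
-/

-- the summit and its single problem share the name (D-0017 nested layout)
set_option linter.dupNamespace false

open MeasureTheory Set Function Filter Topology Metric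
open scoped ENNReal NNReal

namespace Summit.NavierStokesRegularity.NavierStokesRegularity.Theorems.CertifiedBlowupVorticityRateBlowup.InnerObject

open Literature.Analysis.FluidPDE
open Summit.NavierStokesRegularity.OSWSelfSimilar.TypeIIModulationDictionary

section Rate

variable {ν T : ℝ} {u : ℝ → EuclideanSpace ℝ (Fin 3) → EuclideanSpace ℝ (Fin 3)}
  {tn lamn : ℕ → ℝ} {cn : ℕ → EuclideanSpace ℝ (Fin 3)} {φ : ℕ → ℕ}
  {W : ℝ → EuclideanSpace ℝ (Fin 3) → EuclideanSpace ℝ (Fin 3)} {C : ℝ}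

/-- Zoom times `tₖ + (λₖ²/ν)s` (`s < 0`) tend to `T` from below along the gauge data. [folklore] -/
theorem zoomTime_tendsto_nhdsLT (hν : 0 < ν) (htn : ∀ k, T / 2 ≤ tn k ∧ tn k < T) (htT : Tendsto tn atTop (𝓝 T))
    (hlam0 : Tendsto lamn atTop (𝓝 0)) (hφ : StrictMono φ) {s : ℝ} (hs : s < 0) :
    Tendsto (fun j => tn (φ j) + lamn (φ j) ^ 2 / ν * s) atTop (𝓝[<] T) := by
  refine tendsto_nhdsWithin_iff.2 ⟨?_, Eventually.of_forall fun j => ?_⟩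
  · have h1 : Tendsto (fun j => lamn (φ j) ^ 2 / ν * s) atTop (𝓝 0) := by
      simpa using (((hlam0.comp hφ.tendsto_atTop).pow 2).div_const ν).mul_const s
    simpa using (htT.comp hφ.tendsto_atTop).add h1
  · have h2 : lamn (φ j) ^ 2 / ν * s ≤ 0 :=
      mul_nonpos_of_nonneg_of_nonpos (div_nonneg (sq_nonneg _) hν.le) hs.le
    show tn (φ j) + lamn (φ j) ^ 2 / ν * s < T
    linarith [(htn (φ j)).2]

/-- **The inner object's vorticity decays like `C_ω/|s|` into the past** for a witness of the certificate class: if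
`(T − t)‖ω(t, x)‖ ≤ C_ω` for `t` near `T⁻` and the zoomed vorticity `(λₖ²/ν)ω(tₖ + (λₖ²/ν)s, cₖ + λₖy)` converges to
`curl W(s)(y)`, then `‖curl W(s)(y)‖ ≤ C_ω/|s|` (`s < 0`). [cite: KochNadirashviliSereginSverak2009, §6 (zoom bookkeeping)] -/
theorem vorticityRate_innerObject_curl_le (hν : 0 < ν) (htn : ∀ k, T / 2 ≤ tn k ∧ tn k < T)
    (htT : Tendsto tn atTop (𝓝 T)) (hlam0 : Tendsto lamn atTop (𝓝 0)) (hφ : StrictMono φ)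
    (hrate : ∀ᶠ t in 𝓝[<] T, ∀ x, (T - t) * ‖curl (u t) x‖ ≤ C)
    (hcurl : ∀ s < 0, ∀ y : EuclideanSpace ℝ (Fin 3), Tendsto (fun j => (lamn (φ j) ^ 2 / ν) •
      curl (u (tn (φ j) + lamn (φ j) ^ 2 / ν * s)) (cn (φ j) + lamn (φ j) • y)) atTop (𝓝 (curl (W s) y)))
    {s : ℝ} (hs : s < 0) (y : EuclideanSpace ℝ (Fin 3)) : ‖curl (W s) y‖ ≤ C / |s| := by
  have hev := (zoomTime_tendsto_nhdsLT hν htn htT hlam0 hφ hs).eventually hrate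
  refine le_of_tendsto ((hcurl s hs y).norm) ?_
  filter_upwards [hev] with j hj
  set μ : ℝ := lamn (φ j) ^ 2 / ν with hμ
  have hμ0 : 0 ≤ μ := div_nonneg (sq_nonneg _) hν.le
  have hgap : μ * |s| ≤ T - (tn (φ j) + μ * s) := by
    rw [abs_of_neg hs]; nlinarith [(htn (φ j)).2]
  have h := hj (cn (φ j) + lamn (φ j) • y)
  -- `μ‖ω‖ ≤ C/|s|` from `(T − t')‖ω‖ ≤ C` and `μ|s| ≤ T − t'`
  rw [norm_smul, Real.norm_eq_abs, abs_of_nonneg hμ0, le_div_iff₀ (abs_pos.2 hs.ne)]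
  calc μ * ‖curl (u (tn (φ j) + μ * s)) (cn (φ j) + lamn (φ j) • y)‖ * |s|
      = (μ * |s|) * ‖curl (u (tn (φ j) + μ * s)) (cn (φ j) + lamn (φ j) • y)‖ := by ring
    _ ≤ (T - (tn (φ j) + μ * s)) * ‖curl (u (tn (φ j) + μ * s)) (cn (φ j) + lamn (φ j) • y)‖ :=
        mul_le_mul_of_nonneg_right hgap (norm_nonneg _)
    _ ≤ C := h

/-- **Type I along the gauge times in the swirling branch.** If moreover `curl W(s₀)(y₀) ≠ 0` for some `s₀ < 0` and
`(λₖ/ν)‖u‖ ≤ 1` on `[0, tₖ] × ℝ³`, then for all large `k`: `ν(T − tₖ) ≤ (2C_ω/‖curl W(s₀)(y₀)‖)·λₖ²` and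
`‖u(t, x)‖²(T − tₖ) ≤ 2νC_ω/‖curl W(s₀)(y₀)‖` for every `(t, x) ∈ [0, tₖ] × ℝ³`. [cite: KochNadirashviliSereginSverak2009, §6 (zoom bookkeeping)] -/
theorem vorticityRate_typeI_along_gauge_of_curl_ne_zero (hν : 0 < ν) (htn : ∀ k, T / 2 ≤ tn k ∧ tn k < T)
    (htT : Tendsto tn atTop (𝓝 T)) (hlam : ∀ k, 0 < lamn k) (hlam0 : Tendsto lamn atTop (𝓝 0)) (hφ : StrictMono φ)
    (hgauge : ∀ k, ∀ t ∈ Icc 0 (tn k), ∀ x, lamn k / ν * ‖u t x‖ ≤ 1)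
    (hrate : ∀ᶠ t in 𝓝[<] T, ∀ x, (T - t) * ‖curl (u t) x‖ ≤ C)
    (hcurl : ∀ s < 0, ∀ y : EuclideanSpace ℝ (Fin 3), Tendsto (fun j => (lamn (φ j) ^ 2 / ν) •
      curl (u (tn (φ j) + lamn (φ j) ^ 2 / ν * s)) (cn (φ j) + lamn (φ j) • y)) atTop (𝓝 (curl (W s) y)))
    {s₀ : ℝ} (hs₀ : s₀ < 0) {y₀ : EuclideanSpace ℝ (Fin 3)} (hne : curl (W s₀) y₀ ≠ 0) :
    (∀ᶠ j in atTop, ν * (T - tn (φ j)) ≤ 2 * C / ‖curl (W s₀) y₀‖ * lamn (φ j) ^ 2) ∧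
      ∀ᶠ j in atTop, ∀ t ∈ Icc 0 (tn (φ j)), ∀ x, ‖u t x‖ ^ 2 * (T - tn (φ j)) ≤ 2 * ν * C / ‖curl (W s₀) y₀‖ := by
  set w₀ : ℝ := ‖curl (W s₀) y₀‖ with hw₀
  have hw₀pos : 0 < w₀ := norm_pos_iff.2 hne
  have hev := (zoomTime_tendsto_nhdsLT hν htn htT hlam0 hφ hs₀).eventually hrate
  have hbig : ∀ᶠ j in atTop, w₀ / 2 < ‖(lamn (φ j) ^ 2 / ν) •
      curl (u (tn (φ j) + lamn (φ j) ^ 2 / ν * s₀)) (cn (φ j) + lamn (φ j) • y₀)‖ :=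
    ((hcurl s₀ hs₀ y₀).norm).eventually (lt_mem_nhds (by linarith))
  have hmain : ∀ᶠ j in atTop, ν * (T - tn (φ j)) ≤ 2 * C / w₀ * lamn (φ j) ^ 2 := by
    filter_upwards [hev, hbig] with j hj hj2
    set μ : ℝ := lamn (φ j) ^ 2 / ν with hμ
    have hμ0 : 0 < μ := div_pos (pow_pos (hlam (φ j)) 2) hν
    have hμν : μ * ν = lamn (φ j) ^ 2 := by rw [hμ]; field_simp
    set ω : ℝ := ‖curl (u (tn (φ j) + μ * s₀)) (cn (φ j) + lamn (φ j) • y₀)‖ with hω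
    have h1 : (T - (tn (φ j) + μ * s₀)) * ω ≤ C := hj (cn (φ j) + lamn (φ j) • y₀)
    have h2 : w₀ / 2 < μ * ω := by
      rw [norm_smul, Real.norm_eq_abs, abs_of_pos hμ0] at hj2; exact hj2
    have hgap : T - tn (φ j) ≤ T - (tn (φ j) + μ * s₀) := by nlinarith [mul_pos hμ0 (neg_pos.2 hs₀)]
    have hpos : 0 ≤ T - tn (φ j) := by linarith [(htn (φ j)).2]
    have hω0 : 0 ≤ ω := norm_nonneg _
    -- `(T − tₖ) w₀ ≤ 2 C μ`
    have hkey : (T - tn (φ j)) * w₀ ≤ 2 * C * μ := by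
      calc (T - tn (φ j)) * w₀ ≤ (T - tn (φ j)) * (2 * (μ * ω)) := by
            exact mul_le_mul_of_nonneg_left (by linarith) hpos
        _ = 2 * μ * ((T - tn (φ j)) * ω) := by ring
        _ ≤ 2 * μ * ((T - (tn (φ j) + μ * s₀)) * ω) := by
            exact mul_le_mul_of_nonneg_left (mul_le_mul_of_nonneg_right hgap hω0) (by positivity)
        _ ≤ 2 * μ * C := mul_le_mul_of_nonneg_left h1 (by positivity)
        _ = 2 * C * μ := by ring
    rw [div_mul_eq_mul_div, le_div_iff₀ hw₀pos]
    calc ν * (T - tn (φ j)) * w₀ = ν * ((T - tn (φ j)) * w₀) := by ring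
      _ ≤ ν * (2 * C * μ) := mul_le_mul_of_nonneg_left hkey hν.le
      _ = 2 * C * lamn (φ j) ^ 2 := by rw [← hμν]; ring
  refine ⟨hmain, ?_⟩
  filter_upwards [hmain] with j hj t ht x
  have hl0 : 0 < lamn (φ j) := hlam (φ j)
  have hu : ‖u t x‖ ≤ ν / lamn (φ j) := by
    have h := hgauge (φ j) t ht x
    rw [le_div_iff₀ hl0]
    calc ‖u t x‖ * lamn (φ j) = ν * (lamn (φ j) / ν * ‖u t x‖) := by field_simp
      _ ≤ ν * 1 := mul_le_mul_of_nonneg_left h hν.le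
      _ = ν := mul_one ν
  have hTt : T - tn (φ j) ≤ 2 * C / w₀ * lamn (φ j) ^ 2 / ν := by
    rw [le_div_iff₀ hν, mul_comm]; exact hj
  have hpos : 0 ≤ T - tn (φ j) := by linarith [(htn (φ j)).2]
  calc ‖u t x‖ ^ 2 * (T - tn (φ j)) ≤ (ν / lamn (φ j)) ^ 2 * (2 * C / w₀ * lamn (φ j) ^ 2 / ν) :=
        mul_le_mul (pow_le_pow_left₀ (norm_nonneg _) hu 2) hTt hpos (by positivity)
    _ = 2 * ν * C / w₀ := by field_simp

/-- **A WITNESS OF THE CERTIFICATE CLASS AT THE VELOCITY SCALE** (crux `CertifiedBlowupVorticityRateBlowup`'s class): for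
`(ν, T, u, p)` with `IsMaximalSmoothSolution ν 0 u p T`, Leray–Hopf from a rapidly decaying axisymmetric datum, and the
dynamic-rescaling rate `(T − t)‖ω(t, ·)‖_∞ ≤ C_ω` near `T⁻`: the zone-Z1 gauge N-a zoom data and inner object `W`
(`tₖ → T`, `λₖ → 0`, `(λₖ/ν)‖u‖ ≤ 1` on `[0, tₖ]`, zoom `→ W` a KNSS blow-up limit, zoomed vorticity `→ curl W`) with
**`‖curl W(s)(y)‖ ≤ C_ω/|s|`** for all `s < 0`, and EITHER (α) `W ≡ c`, `‖c‖ = 1`, `c₁ = 0`, zoomed vorticity `→ 0`, OR (β) the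
centres lie on the axis, `W` refutes `AxisymmetricLiouvilleBoundedSwirl`, `curl W(s₀)(y₀) ≠ 0` for some `s₀ < 0`, AND THE
BLOW-UP IS TYPE I ALONG THE GAUGE TIMES: `ν(T − tₖ) ≤ K λₖ²` and `‖u(t,x)‖²(T − tₖ) ≤ νK` on `[0, tₖ] × ℝ³` for all large `k`
(`K = 2C_ω/‖curl W(s₀)(y₀)‖`). [cite: KochNadirashviliSereginSverak2009, §6 (zoom bookkeeping)] -/
theorem vorticityRate_witness_innerObject_alternative {p : ℝ → EuclideanSpace ℝ (Fin 3) → ℝ} (hν : 0 < ν) (hT : 0 < T)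
    (hmax : IsMaximalSmoothSolution ν 0 u p T) (hLH : IsLerayHopfOn T ν 0 (u 0) u)
    (hdec : HasRapidSpatialDecay (u 0)) (haxi : IsAxisymmetric (u 0))
    (hrate : ∃ C : ℝ, ∀ᶠ t in 𝓝[<] T, ∀ x : EuclideanSpace ℝ (Fin 3), (T - t) * ‖curl (u t) x‖ ≤ C) :
    ∃ (C : ℝ) (tn lamn : ℕ → ℝ) (cn : ℕ → EuclideanSpace ℝ (Fin 3)) (φ : ℕ → ℕ)
      (W : ℝ → EuclideanSpace ℝ (Fin 3) → EuclideanSpace ℝ (Fin 3)),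
      (∀ k, T / 2 ≤ tn k ∧ tn k < T) ∧ Tendsto tn atTop (𝓝 T) ∧ (∀ k, 0 < lamn k) ∧ Tendsto lamn atTop (𝓝 0) ∧
      (∀ k, ∀ t ∈ Icc 0 (tn k), ∀ x, lamn k / ν * ‖u t x‖ ≤ 1) ∧ StrictMono φ ∧ IsKNSSBlowupLimit W ∧
      (∀ s < 0, TendstoLocallyUniformly
        (fun k => ((lamn (φ k) / ν) • stPull (lamn (φ k) ^ 2 / ν) (lamn (φ k)) (tn (φ k)) (cn (φ k)) u) s)
          (W s) atTop) ∧
      (∀ s < 0, ∀ y : EuclideanSpace ℝ (Fin 3), Tendsto (fun j => (lamn (φ j) ^ 2 / ν) •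
        curl (u (tn (φ j) + lamn (φ j) ^ 2 / ν * s)) (cn (φ j) + lamn (φ j) • y)) atTop (𝓝 (curl (W s) y))) ∧
      (∀ s < 0, ∀ y : EuclideanSpace ℝ (Fin 3), ‖curl (W s) y‖ ≤ C / |s|) ∧
      (((∃ c : EuclideanSpace ℝ (Fin 3), ‖c‖ = 1 ∧ c 1 = 0 ∧ ∀ s < 0, ∀ y : EuclideanSpace ℝ (Fin 3), W s y = c) ∧
          ∀ s < 0, ∀ y : EuclideanSpace ℝ (Fin 3), Tendsto (fun j => (lamn (φ j) ^ 2 / ν) •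
            curl (u (tn (φ j) + lamn (φ j) ^ 2 / ν * s)) (cn (φ j) + lamn (φ j) • y)) atTop (𝓝 0)) ∨
        ((∀ k, cn k 0 = 0 ∧ cn k 1 = 0) ∧
          ¬ Summit.NavierStokesRegularity.NavierStokesRegularity.AxisymmetricLiouvilleBoundedSwirl ∧
          ∃ s₀ < 0, ∃ y₀ : EuclideanSpace ℝ (Fin 3), curl (W s₀) y₀ ≠ 0 ∧
            (∀ᶠ j in atTop, ν * (T - tn (φ j)) ≤ 2 * C / ‖curl (W s₀) y₀‖ * lamn (φ j) ^ 2) ∧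
            ∀ᶠ j in atTop, ∀ t ∈ Icc 0 (tn (φ j)), ∀ x, ‖u t x‖ ^ 2 * (T - tn (φ j)) ≤ 2 * ν * C / ‖curl (W s₀) y₀‖)) := by
  obtain ⟨C, hC⟩ := hrate
  obtain ⟨Mₛ, hMₛ⟩ := hdec.abs_swirl_le
  obtain ⟨tn, lamn, cn, xn, φ, W, htn, htT, hlam, hlam0, hgauge, -, -, -, -, -, -, hφ, hW, hconv, -, hcurl, halt⟩ :=
    innerObject_master_of_datum hν hT hmax hLH hdec haxi hMₛ
  refine ⟨C, tn, lamn, cn, φ, W, htn, htT, hlam, hlam0, hgauge, hφ, hW, hconv, hcurl,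
    fun s hs y => vorticityRate_innerObject_curl_le hν htn htT hlam0 hφ hC hcurl hs y, ?_⟩
  rcases halt with ⟨hc, hzero⟩ | ⟨hax0, hnot, -, -, -, ⟨s₀, hs₀, y₀, hne⟩, -⟩
  · exact Or.inl ⟨hc, hzero⟩
  · obtain ⟨h1, h2⟩ := vorticityRate_typeI_along_gauge_of_curl_ne_zero hν htn htT hlam hlam0 hφ hgauge hC hcurl hs₀ hne
    exact Or.inr ⟨hax0, hnot, s₀, hs₀, y₀, hne, h1, h2⟩

end Rate

end Summit.NavierStokesRegularity.NavierStokesRegularity.Theorems.CertifiedBlowupVorticityRateBlowup.InnerObject
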